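import Summits.PneNP.PneNP.Theorems.ForcedSplitsSandwich
import Summits.PneNP.PneNP.Theorems.ForcedSplitsAccountingLemma

/-!
# Crux `FlowDefectFloor` (stmt-PneNP-8174, route ForcedSplits) — birth skeleton `Lines/birth.lean`

The crux is the route's thesis X (rank 0, auto-crux `underived-target`): every polynomial-time
predicate `f` accepting (the encoding of) every satisfiable CNF has, for some `C`, splitting-identity
violation mass `E_J[nviol] ≥ n^{-C}` along the unit-propagation-guided restriction flow from
`F₃(n, 6n)` for infinitely many `n` (wrapped labelling `g = f ∧ [no empty clause]`). The route's
deciding theorem consumes only `X` and the proved `Assembly : X → PneNP`, so `X` is at-least-summit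
and must be REDIRECTED onto ≥ 2 load-bearing pieces (BC2 redirect rule) — this file is that redirect,
exactly the route header's "Foreseen split 1":

  `FlowDefectFloor ⇐ CleanExitBound ∧ FeigeHypothesis 6`
  (glue: the LANDED `Sandwich` (stmt-PneNP-8179, `forcedSplits_sandwich_proof`) fed with the LANDED
  `AccountingLemma` (stmt-PneNP-8178, `forcedSplits_accountingLemma_proof`)).

THE LINE (sandwich / calibration). `AccountingLemma` turns self-consistency into soundness on the
flow: `Pr[root unsat ∧ g(root) ∧ path unclean] ≤ E[nviol g]`. If a polynomial-time `f ⊇ SAT` had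
violation mass `< n^{-(c+1)}` eventually, then `Pr[g(root) ∧ unclean] < n^{-(c+1)} + 2ⁿ(7/8)^{6n} ≤ n^{-c}`
(first moment, tree `forcedSplits_prob_satisfiable_le`), so by the DENSE CLEAN-EXIT BOUND `g` accepts
`< 1/3` of the roots eventually, i.e. `¬f` is a sound polynomial-time refuter accepting `> 2/3 ≥ 1/2`
of `F₃(n, 6n)` — contradicting Feige's Hypothesis 1 at `Δ = 6`. Two named pieces, no seam beyond the
two landed theorems:

* `stub_cleanExitBound` — **the combinatorial piece = the route's rank-2 crux `CleanExitBound`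
  (stmt-PneNP-8175) BY NAME** (shared decl; its own crux chain is where its lines live): for `n ≥ N`
  and EVERY labelling `g : CNF → Bool` vanishing on formulas with the empty clause (no complexity
  bound), `Pr[g(root)] ≥ 1/3 ⇒ Pr[g(root) ∧ path unclean for g] ≥ n^{-c}`. A statement about one
  explicit Markov chain (UC / ordered-DLL trajectory on `F₃(n,6n)`) with no algorithm in it. Size XL.
  Why it might fail (route header): a dense history-free labelling with one-sided self-stabilising
  exits (marker adversaries already force `c ≥ 1/2`).
* `stub_feigeHypothesis_six` — **the complexity piece = `Literature.Computability.Complexity.FeigeHypothesis 6`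
  BY NAME** (Feige 2002 §1 Hypothesis 1, deterministic satisfiable-sound form at density 6; the
  shared node with route Feige, whose thesis `FeigeThesis = ∀ Δ > 0, FeigeHypothesis Δ` gives it in
  one line). HONEST FLAG (BC3 (c), recorded in the seat's NOTES.md): this piece is SUMMIT-STRENGTH
  mathematically — `FeigeHypothesis 6 → PneNP` by the first-moment bound at `Δ = 6 > log 2 / log(8/7)`
  plus `SAT ∈ NP` (the argument of route Feige's `closes`); no single landed theorem has that shape
  (`lean search FeigeHypothesis`, 2026-08-17), and the mechanical probes below FAIL as required. This
  is intrinsic to the crux, not an artefact of the cut: `X` quantifies over all polynomial-time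
  SAT-complete `f`, the exact SAT labelling is violation-free, so whichever piece covers the
  low-acceptance `f` carries `P ≠ NP`-strength; the route header says as much ("FH6 ∧ C1 ⇒ X ⇒ P ≠ NP";
  "the items reach X only through FeigeHypothesis 6"). The NON-Feige content of `X` is exactly
  `CleanExitBound`.
* `FlowDefectFloor_of : FlowDefectFloor` — THE skeleton theorem: the crux BY NAME (type literally the
  route decl), a real term — `forcedSplits_sandwich_proof stub_cleanExitBound
  forcedSplits_accountingLemma_proof stub_feigeHypothesis_six`; the file's only `sorry`s are the two
  stubs. (No explicit-hypothesis variant is declared on purpose: the landed `Sandwich` already is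
  `CleanExitBound → AccountingLemma → FeigeHypothesis 6 → FlowDefectFloor`, and a second theorem
  headed by the crux name would make the skeleton audit's choice of theorem ambiguous.)

Hardest stub: `stub_cleanExitBound` (XL; open; the route's load-bearing bet). `stub_feigeHypothesis_six`
is conjecture-grade (Feige 2002) and is not expected to be proved inside this route — it is the
calibration hypothesis the route shares with route Feige.

Disproof used: none exists (`ledger crux ls stmt-PneNP-8174`: no workfiles, 2026-08-17). Negatives
(`ledger negatives --problem PneNP`, 5 entries): none concerns the UC flow, clean exits or Feige's
hypothesis; neither stub is an instance of a refuted statement.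

BC3 probes (seat folder `bc/probe_*.lean`, outputs in the seat's NOTES.md): for each stub `S`,
`S → FlowDefectFloor` and `S → PneNP` by `first | exact? | simpa | aesop` (and the BC.md variant with
`simpa [S] | (unfold S; simpa)`) FAIL — 4/4 mandatory probes fail; converse probes recorded too.

References: U. Feige, *Relations between average case complexity and approximation complexity*,
STOC 2002, §1 Hypothesis 1 [Feige2002]; D. Achlioptas, P. Beame, M. Molloy, JCSS 68 (2004)
[AchlioptasBeameMolloy2004]; M.-T. Chao, J. Franco, SIAM J. Comput. 15 (1986) [ChaoFranco1986];
V. Chvátal, E. Szemerédi, J. ACM 35 (1988) [ChvatalSzemeredi1988].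
Planner planner-skel-stmt-PneNP-8174-0, 2026-08-17.
-/

set_option linter.dupNamespace false -- `Summit.PneNP.PneNP.…` is the layout-mandated namespace

namespace Summit.PneNP.PneNP.Cruxes.FlowDefectFloor.Birth

open Literature.Computability.Complexity
open Summit.PneNP.PneNP.Theses.ForcedSplits Summit.PneNP.PneNP.Theorems

/-! ## The two registered stubs -/

/-- **Stub 1 — the DENSE CLEAN-EXIT BOUND, i.e. the route's crux `CleanExitBound` (stmt-PneNP-8175) by
name.** There are `c, N` such that for all `n ≥ N` and every labelling `g : CNF ℕ → Bool` vanishing on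
formulas containing the empty clause, if `g` accepts at least a third of the roots of `F₃(n, 6n)` then
with probability `≥ n^{-c}` the UP-guided path is UNCLEAN for `g` (accepted root, but the label
sequence is not `1…10…0` with its unique drop at a free step whose sibling is labelled `true`).
Why plausibly true: on an accepted unsatisfiable root the labels must fall from `1` to `0`; a clean
fall needs a free step whose two children the labelling separates, and for a DENSE labelling the
anti-correlated statistics that could do this (`S − R`) re-cross or die two-sidedly at rate `≥ n^{-1/2}`
(route header, §Adversary census). Size XL. Leans on: `randomKCNF`, `PMF.uniformOfFintype`, the
inlined `restrict/step/run/clean` of the route file.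
[cite: ChaoFranco1986] [cite: AchlioptasBeameMolloy2004] -/
theorem stub_cleanExitBound : CleanExitBound := by
  sorry

/-- **Stub 2 — Feige's refutation hypothesis at density 6, `FeigeHypothesis 6` by name** (deterministic,
satisfiable-sound form: no polynomial-time sound refuter accepts `F₃(n, ⌈6n⌉)` with probability `≥ 1/2`
for all large `n`). The calibration hypothesis of the sandwich `FH6 ∧ CleanExitBound ⇒ X ⇒ PneNP`;
shared with route Feige (`FeigeThesis → FeigeHypothesis 6` is `fun h => h 6 (by norm_num)`).
Summit-strength on its own (it implies `PneNP` by first moment + `SAT ∈ NP`; flagged, see the module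
docstring) — but it does NOT give the crux on its own (the probe `FeigeHypothesis 6 → FlowDefectFloor`
fails: the clean-exit bound is the missing content). Size: conjecture-grade.
[cite: Feige2002, §1 Hypothesis 1] -/
theorem stub_feigeHypothesis_six : FeigeHypothesis 6 := by
  sorry

/-! ## The proved composition -/

/-- **THE SKELETON THEOREM `FlowDefectFloor_of`.** The crux
`Summit.PneNP.PneNP.Theses.ForcedSplits.FlowDefectFloor`, concluded BY NAME from the two DECLARED stubs
through the landed calibration glue `forcedSplits_sandwich_proof :
CleanExitBound → AccountingLemma → FeigeHypothesis 6 → FlowDefectFloor` (stmt-PneNP-8179) and the landed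
`forcedSplits_accountingLemma_proof : AccountingLemma` (stmt-PneNP-8178). Sorry-free apart from the stubs;
once both stubs land, this term (with the stub names replaced by the landed theorems) is the proof to
propose with `--workitem stmt-PneNP-8174`. -/
theorem FlowDefectFloor_of : FlowDefectFloor :=
  forcedSplits_sandwich_proof stub_cleanExitBound forcedSplits_accountingLemma_proof
    stub_feigeHypothesis_six

end Summit.PneNP.PneNP.Cruxes.FlowDefectFloor.Birth
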